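import Summits.AtomisticToContinuum.Crystallization.Theses.BraggSlacknessRigidity
import Literature.MathematicalPhysics.StatisticalMechanics.CrystallizationLocalLimit
import Literature.MathematicalPhysics.StatisticalMechanics.LocalMatchingCompactness
import Summits.AtomisticToContinuum.Crystallization.Theorems.BraggSlacknessRigidityHcpDiffractionRigidityDenseCentres
import Summits.AtomisticToContinuum.Crystallization.Theorems.BraggSlacknessRigidityHcpDiffractionRigidityQuietCentres
import Summits.AtomisticToContinuum.Crystallization.Theorems.BraggSlacknessRigidityHcpDiffractionRigidityAdmissibleApprox
import Summits.AtomisticToContinuum.Crystallization.Theorems.BraggSlacknessRigidityHcpDiffractionRigidityDiagonalCentres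
import Summits.AtomisticToContinuum.Crystallization.Theorems.BraggSlacknessRigidityHcpDiffractionRigidityWindowsReturn
import Summits.AtomisticToContinuum.Crystallization.Theorems.BraggSlacknessRigidityHcpDiffractionRigidityLocalLimitTransfer
import Summits.AtomisticToContinuum.Crystallization.Theorems.BraggSlacknessRigidityHcpDiffractionRigidityLatticeConfinementRat
import Summits.AtomisticToContinuum.Crystallization.Theorems.BraggSlacknessRigidityHcpDiffractionRigidityWindowsOfEssentialPeriodicity
import Summits.AtomisticToContinuum.Crystallization.Theorems.BraggSlacknessRigidityHcpDiffractionRigidityEssentialPeriodicityRat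

/-!
# The commensurate case of hcp-template diffraction rigidity
# (`BraggSlacknessRigidity.CommensurateHcpRigidity`, item `stmt-AtomisticToContinuum-13168`)

For an hcp template `P = hcpPeriodicConfiguration a h` with COMMENSURATE spacings `h² = q a²`
(`q ∈ ℚ`; the ideal hcp has `q = 2/3`), every hard-core sequence of finite configurations whose
pair distances are asymptotically template distances (S2) and whose structure factor is
asymptotically quiet off `{0} ∪` the Bragg spheres of `P` (S3) has a crystalline local limit: a
re-centred subsequence converges locally to a periodic configuration with multiplicities.

This is the assembly of the pieces landed for the crux `HcpDiffractionRigidity` (line `registered`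
of item `stmt-AtomisticToContinuum-13166`), all of which are unconditional in the commensurate case:
typical centres (A1 dense centres, A2 quiet centres, A3 admissible approximation, A4 diagonal
choice), local limits with inherited exactness and quietness (B1), lattice confinement by Gram
integrality (B2a), essential periodicity from the quiet spectrum (B2b), periodic windows (B2b'),
return of the windows to the finite configurations (B3), and the Literature matching lemma
`PeriodicConfiguration.tendsto_sum_of_eventually_near'`.

All `[folklore]` as assembly; the mathematics is in the imported files.
-/

noncomputable section

namespace Summit.AtomisticToContinuum.Crystallization.Theorems

namespace CommensurateHcpRigidityProof

open Literature.MathematicalPhysics.StatisticalMechanics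
open scoped BigOperators Classical
open Filter

/-- **Rigidity of one quiet exact limit set, commensurate template.** For `h² = q a²`, a
`δ`-separated `Λ ∋ 0` all of whose pair distances are hcp template distances and whose Gaussian
windows are quiet off the Bragg set contains, for every radius, an `ε`-exact translated window of
ONE periodic configuration (B2a + B2b + B2b'). [folklore] -/
theorem limitRigidity_commensurate (a h : ℝ) (ha : a ≠ 0) (hh : h ≠ 0)
    (hq : ∃ q : ℚ, h ^ 2 = (q : ℝ) * a ^ 2) (δ : ℝ) (hδ : 0 < δ) (Λ : Set (EuclideanSpace ℝ (Fin 3)))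
    (hsep : ∀ p ∈ Λ, ∀ q ∈ Λ, p ≠ q → δ ≤ dist p q) (h0 : (0 : EuclideanSpace ℝ (Fin 3)) ∈ Λ)
    (hE : ∀ p ∈ Λ, ∀ q ∈ Λ, ∃ a' ∈ (hcpPeriodicConfiguration ha hh).points,
      ∃ b' ∈ (hcpPeriodicConfiguration ha hh).points, dist p q = dist a' b')
    (hQ : ∃ L : ℕ → ℝ, Filter.Tendsto L Filter.atTop Filter.atTop ∧ ∀ g : EuclideanSpace ℝ (Fin 3) → ℝ, Continuous g →
      HasCompactSupport g → (∀ ξ ∈ tsupport g, ξ ≠ 0 ∧ ∀ k : EuclideanSpace ℝ (Fin 3),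
        (∀ v ∈ (hcpPeriodicConfiguration ha hh).lattice, ∃ n : ℤ, inner ℝ k v = (n : ℝ)) → ‖ξ‖ ≠ ‖k‖) →
      ∀ ε : ℝ, 0 < ε → ∀ᶠ t : ℕ in Filter.atTop, (∫ ξ, g ξ * ‖∑' s : Λ,
        (Real.exp (-(‖(s : EuclideanSpace ℝ (Fin 3))‖ ^ 2) / L t ^ 2) : ℂ) *
          Complex.exp (2 * Real.pi * Complex.I * (inner ℝ ξ (s : EuclideanSpace ℝ (Fin 3)) : ℂ))‖ ^ 2) ≤
        ε * ∑' s : Λ, Real.exp (-(‖(s : EuclideanSpace ℝ (Fin 3))‖ ^ 2) / L t ^ 2) ^ 2) :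
    ∃ Q : Literature.MathematicalPhysics.StatisticalMechanics.PeriodicConfiguration 3, ∀ R ε : ℝ, 0 < ε → ∃ c : EuclideanSpace ℝ (Fin 3),
      (∀ s ∈ Q.points, ‖s‖ ≤ R → ∃ p ∈ Λ, dist (p - c) s ≤ ε) ∧
      (∀ p ∈ Λ, ‖p - c‖ ≤ R → ∃ s ∈ Q.points, dist (p - c) s ≤ ε) := by
  obtain ⟨M, hMd, hMspan, hMgram, hΛM⟩ := stub_latticeConfinementRat a h ha hh hq Λ h0 hE
  obtain ⟨M', k, hk, hM'M, hkM, hess⟩ :=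
    stub_essentialPeriodicityRat a h ha hh hq δ hδ Λ hsep h0 M hMd hMspan hMgram hΛM hQ
  exact stub_windowsOfEssentialPeriodicity δ hδ Λ hsep h0 M hMd hMspan hΛM M' k hk hM'M hkM hess

/-- **Rigidity of quiet exact windows, commensurate template (Goal B).** A hard-core sequence of
finite configurations centred at a particle, with asymptotically exact windows and Gaussian-quiet
windows, has a re-centred subsequence eventually two-way matched with ONE periodic configuration
on every ball (B1 + `limitRigidity_commensurate` + B3). [folklore] -/
theorem quietExactWindowsRigidity_commensurate (a h : ℝ) (ha : a ≠ 0) (hh : h ≠ 0)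
    (hq : ∃ q : ℚ, h ^ 2 = (q : ℝ) * a ^ 2) (δ : ℝ) (hδ : 0 < δ) (n : ℕ → ℕ)
    (y : (j : ℕ) → (Fin (n j) → EuclideanSpace ℝ (Fin 3)))
    (hsep : ∀ (j : ℕ) (i i' : Fin (n j)), i ≠ i' → δ ≤ dist (y j i) (y j i'))
    (h0 : ∀ j : ℕ, ∃ i : Fin (n j), y j i = 0)
    (hE : ∀ R η : ℝ, 0 < η → ∀ᶠ j : ℕ in Filter.atTop, ∀ i i' : Fin (n j), i ≠ i' → ‖y j i‖ ≤ R →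
      ‖y j i'‖ ≤ R → ∃ a' ∈ (hcpPeriodicConfiguration ha hh).points,
        ∃ b' ∈ (hcpPeriodicConfiguration ha hh).points, |dist (y j i) (y j i') - dist a' b'| < η)
    (hQ : ∃ L : ℕ → ℝ, Filter.Tendsto L Filter.atTop Filter.atTop ∧ ∀ g : EuclideanSpace ℝ (Fin 3) → ℝ, Continuous g →
      HasCompactSupport g → (∀ ξ ∈ tsupport g, ξ ≠ 0 ∧ ∀ k : EuclideanSpace ℝ (Fin 3),
        (∀ v ∈ (hcpPeriodicConfiguration ha hh).lattice, ∃ n : ℤ, inner ℝ k v = (n : ℝ)) → ‖ξ‖ ≠ ‖k‖) →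
      ∀ ε : ℝ, 0 < ε → ∀ᶠ t : ℕ in Filter.atTop, ∀ᶠ j : ℕ in Filter.atTop,
        (∫ ξ, g ξ * ‖∑ i : Fin (n j), (Real.exp (-(‖y j i‖ ^ 2) / L t ^ 2) : ℂ) *
          Complex.exp (2 * Real.pi * Complex.I * (inner ℝ ξ (y j i) : ℂ))‖ ^ 2) ≤
        ε * ∑ i : Fin (n j), Real.exp (-(‖y j i‖ ^ 2) / L t ^ 2) ^ 2) :
    ∃ (ψ : ℕ → ℕ) (σ : ℕ → EuclideanSpace ℝ (Fin 3)) (Q : Literature.MathematicalPhysics.StatisticalMechanics.PeriodicConfiguration 3), StrictMono ψ ∧ ∀ R ε : ℝ, 0 < ε →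
      ∀ᶠ k : ℕ in Filter.atTop, (∀ s ∈ Q.points, ‖s‖ ≤ R → ∃ i : Fin (n (ψ k)), dist (y (ψ k) i + σ k) s ≤ ε) ∧
        (∀ i : Fin (n (ψ k)), ‖y (ψ k) i + σ k‖ ≤ R → ∃ s ∈ Q.points, dist (y (ψ k) i + σ k) s ≤ ε) := by
  obtain ⟨ψ, Λ, hψ, hΛsep, hΛ0, hΛE, hΛQ, hconv⟩ :=
    stub_localLimitTransfer (hcpPeriodicConfiguration ha hh) δ hδ n y hsep h0 hE hQ
  obtain ⟨Q, hwin⟩ := limitRigidity_commensurate a h ha hh hq δ hδ Λ hΛsep hΛ0 hΛE hΛQ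
  obtain ⟨κ, σ, hκ, hmatch⟩ :=
    stub_windowsReturn (fun k => n (ψ k)) (fun k => y (ψ k)) Λ Q hconv hwin
  exact ⟨fun k => ψ (κ k), σ, Q, hψ.comp hκ, hmatch⟩

end CommensurateHcpRigidityProof

open CommensurateHcpRigidityProof Literature.MathematicalPhysics.StatisticalMechanics Filter in
open scoped Classical in
/-- **The commensurate case of hcp-template diffraction rigidity** (route item
`CommensurateHcpRigidity`, rank-4 crux of route `BraggSlacknessRigidity`): for an hcp template with
`h² = q a²`, `q ∈ ℚ`, hard core + asymptotically exact pair distances (S2) + a structure factor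
quiet off the Bragg spheres (S3) force a crystalline local limit along a re-centred subsequence.
Proof: typical centres (A1–A4), then Goal B in the commensurate case, then the Literature
matching lemma with multiplicity `m ≡ 1`. [folklore] -/
theorem commensurateHcpRigidity_proof :
    Summit.AtomisticToContinuum.Crystallization.Theses.BraggSlacknessRigidity.CommensurateHcpRigidity := by
  unfold Summit.AtomisticToContinuum.Crystallization.Theses.BraggSlacknessRigidity.CommensurateHcpRigidity
  intro P hP δ hδ x hsep hS2 hS3
  obtain ⟨a, h, ha, hh, rfl, hq⟩ := hP
  -- Goal A: typical centres
  obtain ⟨φ, τ, hφ, h0, hex, hquiet⟩ := stub_diagonalCentres (hcpPeriodicConfiguration ha hh) δ hδ x hsep hS2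
    (stub_denseCentres _ δ hδ x hsep hS3) (stub_quietCentres _ δ hδ x hsep hS3)
    (stub_admissibleApprox _ δ hδ)
  -- the hard core is translation invariant
  have hsep' : ∀ (j : ℕ) (i i' : Fin (φ j)), i ≠ i' →
      δ ≤ dist (x (φ j) i + τ j) (x (φ j) i' + τ j) := fun j i i' hne => by
    rw [dist_add_right]
    exact hsep (φ j) i i' hne
  -- Goal B on the re-centred subsequence
  obtain ⟨ψ, σ, Q, hψ, hmatch⟩ := quietExactWindowsRigidity_commensurate a h ha hh hq δ hδ φ
    (fun j i => x (φ j) i + τ j) hsep' h0 hex hquiet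
  refine ⟨fun k => φ (ψ k), fun k => τ (ψ k) + σ k, Q, fun _ => 1, hφ.comp hψ,
    fun s _ => le_rfl, fun g _ s => rfl, fun f hfc hf => ?_⟩
  have hsep'' : ∀ (k : ℕ) (i i' : Fin (φ (ψ k))), i ≠ i' →
      δ ≤ dist (x (φ (ψ k)) i + τ (ψ k) + σ k) (x (φ (ψ k)) i' + τ (ψ k) + σ k) :=
    fun k i i' hne => by
    rw [dist_add_right]
    exact hsep' (ψ k) i i' hne
  have key := Q.tendsto_sum_of_eventually_near' (n := fun k => φ (ψ k))
    (fun k i => x (φ (ψ k)) i + τ (ψ k) + σ k) hδ hsep'' hmatch hfc hf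
  simpa only [add_assoc] using key

end Summit.AtomisticToContinuum.Crystallization.Theorems

end
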